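import Summits.HodgeConjecture.HodgeConjecture.Theses.IncidenceNodePeeling
import Literature.AlgebraicGeometry.HodgeTheory.HypersurfaceLefschetzUpper

/-!
# Route IncidenceNodePeeling — `HypersurfaceMiddleReduction` (support item stmt-HodgeConjecture-2350)

For smooth hypersurfaces the Hodge conjecture reduces to the middle degree of the even-dimensional
ones: Hodge models by hypothesis, the middle degree `2p = n` by hypothesis, and `algebraicClasses X p = ⊤`
off the middle degree — Lefschetz's theorem on hyperplane sections for `0 < p < n` (the tree's
discharged named fact `Voisin2003_smoothHypersurface_algebraicClasses_eq_top_holds`) and the elementary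
degrees `p = 0`, `p ≥ n` (`algebraicClasses_eq_top_of_eq_zero_or_le`).  No named-fact hypothesis, no
sorry.
-/

-- `Summit.HodgeConjecture.HodgeConjecture.Theorems` is the mandated namespace (single-problem
-- summit: Problem = Summit), which `linter.dupNamespace` flags on every declaration; the lakefile
-- turns the linter off tree-wide (weak option), restated here so stand-alone elaboration is
-- warning-free too.
set_option linter.dupNamespace false

namespace Summit.HodgeConjecture.HodgeConjecture.Theorems

open Literature.AlgebraicGeometry.Motives Literature.AlgebraicGeometry.HodgeTheory

/-- **Item stmt-HodgeConjecture-2350 (`HypersurfaceMiddleReduction`), route `IncidenceNodePeeling`**: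
models + middle degree by hypothesis, the other degrees by Lefschetz (`0 < p < n`) or trivially.
[cite: VoisinHodgeII2003, Thm. 1.23, Cor. 1.24 and Cor. 1.25] -/
theorem incidenceNodePeeling_hypersurfaceMiddleReduction_proof :
    Summit.HodgeConjecture.HodgeConjecture.Theses.IncidenceNodePeeling.HypersurfaceMiddleReduction := by
  intro hM hmid n d X hY
  refine ⟨hM n X hY.1, fun p c hc hpp ↦ ?_⟩
  by_cases hpn : 2 * p = n
  · subst hpn
    exact hmid p d X c hY hc hpp
  · by_cases h : 0 < p ∧ p < n
    · rw [Voisin2003_smoothHypersurface_algebraicClasses_eq_top_holds hY p h.1 h.2 hpn]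
      exact Submodule.mem_top
    · rw [algebraicClasses_eq_top_of_eq_zero_or_le hY.1 (by omega)]
      exact Submodule.mem_top

end Summit.HodgeConjecture.HodgeConjecture.Theorems
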